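import Literature.Geometry.Kaehler.SiegelTorusThetaNullRankModular
import Literature.Geometry.Kaehler.SiegelTorusThetaDivisorSingularDiagonal
import HarnessLib

/-!
# Theta gradients at `z = 0` transform by `(γZ+δ)` under `Sp_{2g}(ℤ)`; the locus `(∂θ)_null` of ppav
# whose theta divisor is singular at an odd two-torsion point is well defined on `𝒜_g`; the gradient of
# `ϑ[ε;δ]` at `z = 0` vanishes identically iff `[ε;δ]` is even

Layer `Literature/Geometry/Kaehler`, namespace `Literature.Geometry.Kaehler.ComplexTorus` (lane
`lit-hodgefound`, Layer A4, theta-divisor row A4-17; prover seat `lit-hodgefound-p23`, row «A4-17(s)»).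
First-order companion of `SiegelTorusThetaNullRankModular.lean` (the `z`-Hessian at a vanishing theta
constant transforms by `ᵗ(γZ+δ)`; the strata `θ_null^h` are `Sp_{2g}(ℤ)`-invariant); sequel of
`SiegelTorusThetaNullModular.lean` (`θ_null` on `𝒜_g`, parity of `M[·]`), `SiegelTorusThetaNullSingular.lean`
(`riemannThetaChar_singular_zero_iff`: `ϑ[a;b]` is singular at `0` iff `ϑ` is singular at `Ωa + b`; even
theta functions are critical at `0`), `SiegelTorusEvenThetaConstants.lean` (the translation step
`Z ↦ Z + Eᵢⱼ + Eⱼᵢ` and the count `#S(k,l)` of (odd, odd) coordinate pairs) and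
`SiegelTorusThetaDivisorSingularDiagonal.lean` (`Sing Θ` of a diagonal period matrix: at least two
coordinates on the genus-one theta divisors).

Sources followed (held texts, read at the quoted chunks).

* S. Grushevsky, R. Salvati Manni, *Gradients of odd theta functions*, J. reine angew. Math. 573 (2004)
  [held `paper:arxiv-math_0310085` p0003 L88–L130]: "The transformation law for theta functions under the
  action of the symplectic group is `θ[γ(ε;δ)](γτ, (cτ+d)^{−t} z) = φ(ε,δ,γ,τ,z) det(cτ+d)^{1/2} θ[ε;δ](τ,z)`
  […] Differentiating the theta transformation law above with respect to `zᵢ` and then evaluating at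
  `z = 0`, we see that […] the gradient vector `{∂θ[ε;δ](τ,0)/∂zᵢ}_{all i}` is a `ℂ^g`-valued modular form
  with respect to `Γ_g(4,8)` under the representation `ρ(M) := (det M)^{1/2} · M`."
* S. Grushevsky, R. Salvati Manni, *The loci of abelian varieties with points of high multiplicity on the
  theta divisor*, Geom. Dedicata 139 (2009) [held `paper:arxiv-0805.4148`]: p0003 L75
  "`(∂θ)_null := {(X_τ, Θ_τ) ∈ 𝒜 ∣ X_τ[2]^odd ∩ Sing Θ_τ ≠ ∅}`"; p0004 L122–L123 "We denote by
  `grad θ[ε;δ](τ)` the gradient of the theta function of characteristic `[ε,δ]` with respect to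
  `z₁, …, z_g` and evaluating at `z = 0`. This gradient is not identically zero if and only if the
  characteristic is odd. The gradient is a vector valued modular form for `ρ = (St, 1/2)` with multiplier
  `v`"; p0006 L7–L8 "On `𝒜_g(2)` for any odd `[ε,δ]` the vector valued equation `grad θ[ε;δ](τ) = 0`
  defines a certain set of components of `(∂θ)_null`. The (possibly reducible) loci `grad θ[ε;δ](τ) = 0`
  for various `ε,δ` are conjugate under the action of `Γ_g`"; p0010 L37 "if `z = (τε+δ)/2 ∈ X_τ[2]` is an
  odd point, then `0 = θ(τ,z) = ∂ᵢ∂ⱼθ(τ,z)` automatically".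

The mechanism (Lange's form of the transformation formula, `M = (α β; γ δ)`, `D := γZ + δ`, the tree's
`exists_riemannThetaChar_transform`): `ϑ[M[c]](ᵗD⁻¹v, M(Z)) = C · e(πi ᵗv D⁻¹γ v) · ϑ[c](v, Z)`,
`C ≠ 0`; the exponential factor has vanishing first derivative at `v = 0`, so differentiating once at
`v = 0` gives `D⁻¹ · grad ϑ[M[c]](·, M(Z))(0) = C · grad ϑ[c](·, Z)(0)` — UNCONDITIONALLY (no vanishing
hypothesis), for every characteristic and every `M ∈ Sp_{2g}(ℤ)`; the constant is Lange's `C(Z, M, c)`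
(the identification `C = κ det(γZ+δ)^{1/2}…` of Thm. 3.3.9 / GSM's `φ det^{1/2}` is not used).

What is here. TWO definitions with bodies (GSM 2009's loci, as predicates on a period matrix) and
theorems; no named fact, net debt `0`.

* §1 `fderiv_comp_mulVec_apply`, `fderiv_mul_apply_of_fderiv_eq_zero` (first-order calculus).
* §2 **`fderiv_riemannThetaChar_moeb_zero_eq`** — `∃ C ≠ 0, ∀ u, ∂_u ϑ[M[c]](·, M(Z))(0) = C · ∂_{ᵗ(γZ+δ)u} ϑ[c](·, Z)(0)`;
  in coordinates **`fderiv_riemannThetaChar_moeb_zero_single_eq`**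
  (`∂ᵢϑ[M[c]](·,M(Z))(0) = C Σⱼ (γZ+δ)ᵢⱼ ∂ⱼϑ[c](·,Z)(0)` — the printed "`Σⱼ (cτ+d)ᵢⱼ ∂θ/∂zⱼ`");
  **`fderiv_riemannThetaChar_moeb_zero_eq_zero_iff`** (the gradient at `0` vanishes at `M(Z)` iff it
  vanishes at `Z`); half-integer form `fderiv_riemannThetaChar_half_moeb_zero_eq_zero_iff`.
* §3 **`MemGradThetaNullAt k l Ω`** (GSM's locus `grad θ[k/2; l/2](Ω) = 0`) and **`MemGradThetaNull Ω`**
  (`Ω ∈ (∂θ)_null`: some ODD characteristic has vanishing gradient — its theta constant vanishes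
  automatically); `MemGradThetaNullAt.of_even` (even characteristics always qualify: `ϑ[k/2;l/2]` is even in
  `z`), `memGradThetaNullAt_add_two_mul_iff` (depends on the characteristic mod `2`); the torus reading
  **`memGradThetaNull_iff_exists_odd_twoTorsion_mem_thetaDivisorSing`** (`Ω ∈ (∂θ)_null ↔` an odd
  two-division point `π(½m)` of `X_Ω` lies on `Sing Θ` — the printed definition);
  **`memGradThetaNullAt_moeb_iff`** ("the loci `grad θ[ε;δ] = 0` for various `ε,δ` are conjugate under
  `Γ_g`": `M(Z) ∈ {grad θ[k';l'] = 0} ↔ Z ∈ {grad θ[k;l] = 0}` with GSM's `M(ε;δ)`), `MemGradThetaNull.moeb`,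
  **`memGradThetaNull_moeb_iff`** (`(∂θ)_null` is well defined on `𝒜_g`), `memGradThetaNullAt_add_intCast_iff`,
  `memGradThetaNull_add_intCast_iff`.
* §4 Odd two-torsion points: **`hessian_riemannThetaChar_half_zero_of_odd`** ("if `z` is an odd point, then `0 = θ = ∂ᵢ∂ⱼθ`
  automatically") and `memThetaNullRankAt_of_odd` (so an ODD characteristic lies in every `θ_{[k,l]}^h`,
  which is why Definition 6 of `θ_null^h` quantifies over even ones).
* §5 **"This gradient is not identically zero if and only if the characteristic is odd"**:
  `fderiv_riemannThetaChar_half_zero_diagonal_ne_zero` (at a diagonal period matrix a characteristic with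
  exactly ONE (odd, odd) coordinate pair has non-zero gradient: simple zeros in genus one),
  **`exists_fderiv_riemannThetaChar_half_zero_ne_zero_of_odd`** (induction on `#S(k,l)` by the translations
  `Z ↦ Z + Eᵢⱼ + Eⱼᵢ`, as for the even theta constants),
  **`forall_fderiv_riemannThetaChar_half_zero_eq_zero_iff_even`** (the printed dichotomy);
  validation: `not_memGradThetaNull_fin_one` (genus one: `Θ = pt` is smooth, `(∂θ)_null = ∅`),
  `memGradThetaNull_diagonal_of_three_le` (a diagonal period matrix of genus `≥ 3` lies in `(∂θ)_null`:
  the odd point with three odd coordinate pairs is a singular point of `Θ = ⋃ᵢ pr_i⁻¹(pt)` — GSM 2009's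
  "family of odd points of order two over `𝒜₁ × 𝒜₁ × 𝒜₁`").

Not here: the identification of the constant with `det(γZ+δ)^{1/2}` and the multiplier `v` (so no
modularity for `Γ_g(4,8)` as such), Salvati Manni's non-vanishing of Jacobian Nullwerte, the loci
`(∂θ)^{(k)}`, `G_k`, the codimension statements of GSM 2009.

## References

* [GrushevskySalvatiManni2004Gradients] S. Grushevsky, R. Salvati Manni, *Gradients of odd theta
  functions*, J. reine angew. Math. 573 (2004), 45–59 (arXiv:math/0310085), p. 3 of the held text.
* [GrushevskySalvatiManni2009HighMultiplicity] S. Grushevsky, R. Salvati Manni, *The loci of abelian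
  varieties with points of high multiplicity on the theta divisor*, Geom. Dedicata 139 (2009), 233–247
  (arXiv:0805.4148), pp. 3, 4, 6, 10 of the held text.
* [GrushevskySalvatiManni2008] S. Grushevsky, R. Salvati Manni, *Jacobians with a vanishing theta-null in
  genus 4*, Israel J. Math. 164 (2008), Definitions 5–6 (p0004 of the held text).
* [Lange2023AbelianVarietiesComplex] H. Lange, *Abelian Varieties over the Complex Numbers* (2023),
  §2.3.4 Prop. 2.3.14, §3.3.1 Lemma 3.3.1, §3.3.3 Thm. 3.3.9.
* [MumfordTata1] D. Mumford, *Tata Lectures on Theta I*, Ch. II §1, §5.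
* [WhittakerWatson1927] E. T. Whittaker, G. N. Watson, *A Course of Modern Analysis*, §21.12.
-/

noncomputable section

open scoped Manifold Topology
open scoped Real
open Set Function Complex Matrix Filter
open Literature.Analysis.SpecialFunctions Literature.Analysis.Complex

namespace Literature.Geometry.Kaehler

namespace ComplexTorus

open Literature.NumberTheory.Automorphic (siegelUpperHalfSpace)
open Literature.NumberTheory.ModularForms.SiegelUpperHalfSpace (moeb denom)

variable {n : ℕ}

/-! ### §1 First-order calculus -/

section Calculus

/-- **First-order chain rule for a linear substitution**: `∂_v(f ∘ A)(x) = ∂_{Av} f(Ax)`.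
[cite: HormanderSCV1973, Thm 2.2.6] -/
theorem fderiv_comp_mulVec_apply {f : (Fin n → ℂ) → ℂ} (hf : Differentiable ℂ f)
    (A : Matrix (Fin n) (Fin n) ℂ) (x v : Fin n → ℂ) :
    fderiv ℂ (fun z ↦ f (A *ᵥ z)) x v = fderiv ℂ f (A *ᵥ x) (A *ᵥ v) := by
  set L : (Fin n → ℂ) →L[ℂ] (Fin n → ℂ) := LinearMap.toContinuousLinearMap (Matrix.toLin' A) with hL
  have hLapp : ∀ z, L z = A *ᵥ z := fun z ↦ by simp [hL]
  have hcomp : (fun z ↦ f (A *ᵥ z)) = f ∘ L := funext fun z ↦ by simp [hLapp]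
  rw [hcomp, fderiv_comp x (hf (L x)) L.differentiableAt, L.fderiv, ContinuousLinearMap.comp_apply,
    hLapp, hLapp]

/-- **First derivative of a product with a critical factor**: `∂_v(e·f)(x) = e(x) ∂_v f(x)` when
`de(x) = 0`. [cite: HormanderSCV1973, Thm 2.2.6] -/
theorem fderiv_mul_apply_of_fderiv_eq_zero {e f : (Fin n → ℂ) → ℂ} {x : Fin n → ℂ}
    (he : DifferentiableAt ℂ e x) (hf : DifferentiableAt ℂ f x) (he0 : fderiv ℂ e x = 0)
    (v : Fin n → ℂ) :
    fderiv ℂ (fun w ↦ e w * f w) x v = e x * fderiv ℂ f x v := by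
  rw [fderiv_fun_mul he hf]
  simp [he0, _root_.add_apply, _root_.smul_apply]

/-- The quadratic form `v ↦ ᵗv S v` is differentiable. [folklore] -/
private theorem differentiable_dotProduct_mulVec_self₂ (S : Matrix (Fin n) (Fin n) ℂ) :
    Differentiable ℂ fun v : Fin n → ℂ ↦ v ⬝ᵥ (S *ᵥ v) := by
  simp only [dotProduct, mulVec]
  fun_prop

/-- `v ↦ C · e(c ᵗv S v)` is entire. [folklore] -/
private theorem differentiable_const_mul_cexp_dotProduct_mulVec₂ (C c : ℂ)
    (S : Matrix (Fin n) (Fin n) ℂ) :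
    Differentiable ℂ fun v : Fin n → ℂ ↦ C * cexp (c * (v ⬝ᵥ (S *ᵥ v))) :=
  (((differentiable_dotProduct_mulVec_self₂ S).const_mul c).cexp).const_mul C

/-- Expansion of a vector of `ℂ^g` in the coordinate vectors `eᵢ = Pi.single i 1`. [folklore] -/
private theorem eq_sum_smul_single₂ (v : Fin n → ℂ) :
    v = ∑ l, v l • (Pi.single l (1 : ℂ) : Fin n → ℂ) := by
  funext i
  simp [Finset.sum_apply, Pi.single_apply]

end Calculus

/-! ### §2 The gradient of `ϑ[c]` at `z = 0` transforms by `(γZ + δ)` -/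

section Transformation

variable {M : Matrix (Fin n ⊕ Fin n) (Fin n ⊕ Fin n) ℤ} {Z : Matrix (Fin n) (Fin n) ℂ}

/-- **Differentiating the theta transformation law at `z = 0`**: for `M = (α β; γ δ) ∈ Sp_{2g}(ℤ)`,
`Z ∈ 𝔥_g` and any characteristic `c = (a, b)` there is `C ≠ 0` (Lange's `C(Z, M, c)`) with
`∂_u ϑ[M[c]](·, M(Z))(0) = C · ∂_{ᵗ(γZ+δ)u} ϑ[c](·, Z)(0)` for all `u ∈ ℂ^g` — the exponential factor
`e(πi ᵗv(γZ+δ)⁻¹γv)` of the transformation formula is critical at `v = 0`, so at first order only the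
linear substitution `ᵗ(γZ+δ)⁻¹` acts. [cite: GrushevskySalvatiManni2004Gradients, p0003 L117–L130 of the held text]
[cite: Lange2023AbelianVarietiesComplex, §3.3.3 Thm. 3.3.9 (p0175)] -/
theorem fderiv_riemannThetaChar_moeb_zero_eq (hM : M ∈ Matrix.symplecticGroup (Fin n) ℤ)
    (hZ : Z ∈ siegelUpperHalfSpace n) (a b : Fin n → ℂ) :
    ∃ C : ℂ, C ≠ 0 ∧ ∀ u : Fin n → ℂ,
      fderiv ℂ (riemannThetaChar (thetaCharFst M a b) (thetaCharSnd M a b)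
          (moeb (M.map ((↑) : ℤ → ℂ)) Z)) 0 u =
        C * fderiv ℂ (riemannThetaChar a b Z) 0 ((denom (M.map ((↑) : ℤ → ℂ)) Z)ᵀ *ᵥ u) := by
  obtain ⟨C, hC, hCF⟩ := exists_riemannThetaChar_transform hM hZ a b
  set P : Matrix (Fin n ⊕ Fin n) (Fin n ⊕ Fin n) ℂ := M.map ((↑) : ℤ → ℂ) with hP
  set D : Matrix (Fin n) (Fin n) ℂ := denom P Z with hD
  set F : (Fin n → ℂ) → ℂ :=
    riemannThetaChar (thetaCharFst M a b) (thetaCharSnd M a b) (moeb P Z) with hF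
  set G : (Fin n → ℂ) → ℂ := riemannThetaChar a b Z with hG
  have hZ' := moeb_intCast_mem hM hZ
  obtain ⟨c', hc', hY'⟩ := exists_pos_mul_sum_sq_le_of_posDef_im _ hZ'.2
  have hFd : Differentiable ℂ F :=
    differentiable_riemannThetaChar _ (fun i j ↦ (hZ'.1.apply i j).symm) hc' hY' _ _
  obtain ⟨c, hc, hY⟩ := exists_pos_mul_sum_sq_le_of_posDef_im Z hZ.2
  have hGd : Differentiable ℂ G :=
    differentiable_riemannThetaChar Z (fun i j ↦ (hZ.1.apply i j).symm) hc hY a b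
  have hDt : IsUnit Dᵀ.det := by
    rw [Matrix.det_transpose]
    exact isUnit_det_denom_intCast hM hZ
  -- the multiplier `e(v) = C · e(πi ᵗv D⁻¹γ v)`: value `C` and derivative `0` at `v = 0`
  set e : (Fin n → ℂ) → ℂ := fun v ↦ C * cexp (π * I * (v ⬝ᵥ ((D⁻¹ * P.toBlocks₂₁) *ᵥ v))) with he
  have hed : Differentiable ℂ e := differentiable_const_mul_cexp_dotProduct_mulVec₂ C (π * I) _
  have he0 : fderiv ℂ e 0 = 0 := fderiv_const_mul_cexp_dotProduct_mulVec_zero C (π * I) _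
  have hex : e 0 = C := by simp [he]
  have hfun : (fun v ↦ F (Dᵀ⁻¹ *ᵥ v)) = fun v ↦ e v * G v := by
    funext v
    rw [hCF v]
  refine ⟨C, hC, fun u ↦ ?_⟩
  have h1 := congrArg (fun φ : (Fin n → ℂ) → ℂ ↦ fderiv ℂ φ 0 (Dᵀ *ᵥ u)) hfun
  rw [fderiv_comp_mulVec_apply hFd, Matrix.mulVec_zero, Matrix.mulVec_mulVec,
    Matrix.nonsing_inv_mul _ hDt, Matrix.one_mulVec,
    fderiv_mul_apply_of_fderiv_eq_zero (hed 0) (hGd 0) he0, hex] at h1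
  exact h1

/-- **In coordinates** ("`∂θ/∂zᵢ … = … Σⱼ (cτ+d)ᵢⱼ ∂θ/∂zⱼ …`"): with `D = γZ + δ`,
`∂ᵢϑ[M[c]](·, M(Z))(0) = C · Σⱼ Dᵢⱼ ∂ⱼϑ[c](·, Z)(0)` — the gradient COLUMN vector transforms by
`grad ↦ C · D · grad`, i.e. by the representation `ρ(D) = (det D)^{1/2} D` up to the identification of
the constant. [cite: GrushevskySalvatiManni2004Gradients, p0003 L117–L130 of the held text]
[cite: GrushevskySalvatiManni2009HighMultiplicity, p0004 L122–L124 of the held text] -/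
theorem fderiv_riemannThetaChar_moeb_zero_single_eq (hM : M ∈ Matrix.symplecticGroup (Fin n) ℤ)
    (hZ : Z ∈ siegelUpperHalfSpace n) (a b : Fin n → ℂ) :
    ∃ C : ℂ, C ≠ 0 ∧ ∀ i : Fin n,
      fderiv ℂ (riemannThetaChar (thetaCharFst M a b) (thetaCharSnd M a b)
          (moeb (M.map ((↑) : ℤ → ℂ)) Z)) 0 (Pi.single i 1) =
        C * ∑ j, denom (M.map ((↑) : ℤ → ℂ)) Z i j *
          fderiv ℂ (riemannThetaChar a b Z) 0 (Pi.single j 1) := by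
  obtain ⟨C, hC, h⟩ := fderiv_riemannThetaChar_moeb_zero_eq hM hZ a b
  refine ⟨C, hC, fun i ↦ ?_⟩
  rw [h (Pi.single i 1)]
  congr 1
  have hcol : (denom (M.map ((↑) : ℤ → ℂ)) Z)ᵀ *ᵥ (Pi.single i (1 : ℂ)) =
      ∑ j, denom (M.map ((↑) : ℤ → ℂ)) Z i j • (Pi.single j (1 : ℂ) : Fin n → ℂ) := by
    rw [eq_sum_smul_single₂ ((denom (M.map ((↑) : ℤ → ℂ)) Z)ᵀ *ᵥ (Pi.single i (1 : ℂ)))]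
    refine Finset.sum_congr rfl fun j _ ↦ ?_
    congr 1
    simp [Matrix.mulVec, dotProduct, Pi.single_apply]
  rw [hcol, map_sum]
  exact Finset.sum_congr rfl fun j _ ↦ by rw [map_smul, smul_eq_mul]

/-- **The vanishing of the gradient at `z = 0` is `Sp_{2g}(ℤ)`-invariant**:
`grad ϑ[M[c]](·, M(Z))(0) = 0 ↔ grad ϑ[c](·, Z)(0) = 0` (`γZ + δ` is invertible, `C ≠ 0`).
[cite: GrushevskySalvatiManni2009HighMultiplicity, p0006 L7–L8 of the held text]
[cite: GrushevskySalvatiManni2004Gradients, p0003 L117–L130 of the held text] -/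
theorem fderiv_riemannThetaChar_moeb_zero_eq_zero_iff (hM : M ∈ Matrix.symplecticGroup (Fin n) ℤ)
    (hZ : Z ∈ siegelUpperHalfSpace n) (a b : Fin n → ℂ) :
    fderiv ℂ (riemannThetaChar (thetaCharFst M a b) (thetaCharSnd M a b)
        (moeb (M.map ((↑) : ℤ → ℂ)) Z)) 0 = 0 ↔
      fderiv ℂ (riemannThetaChar a b Z) 0 = 0 := by
  obtain ⟨C, hC, h⟩ := fderiv_riemannThetaChar_moeb_zero_eq hM hZ a b
  have hDt : IsUnit (denom (M.map ((↑) : ℤ → ℂ)) Z)ᵀ.det := by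
    rw [Matrix.det_transpose]
    exact isUnit_det_denom_intCast hM hZ
  constructor
  · intro h0
    ext v
    have hv := h ((denom (M.map ((↑) : ℤ → ℂ)) Z)ᵀ⁻¹ *ᵥ v)
    rw [h0, Matrix.mulVec_mulVec, Matrix.mul_nonsing_inv _ hDt, Matrix.one_mulVec,
      _root_.zero_apply] at hv
    rw [_root_.zero_apply]
    exact ((mul_eq_zero.1 hv.symm).resolve_left hC)
  · intro h0
    ext u
    rw [h u, h0, _root_.zero_apply, _root_.zero_apply, mul_zero]

/-- **Half-integer characteristics** (GSM's `M(ε;δ)`): with `k' = δk − γl + (γᵗδ)₀`,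
`l' = αl − βk + (αᵗβ)₀`, `grad ϑ[k'/2; l'/2](·, M(Z))(0) = 0 ↔ grad ϑ[k/2; l/2](·, Z)(0) = 0`.
[cite: GrushevskySalvatiManni2009HighMultiplicity, p0006 L7–L8 of the held text]
[cite: GrushevskySalvatiManni2008, Definition 5 (p0004 of the held text)] -/
theorem fderiv_riemannThetaChar_half_moeb_zero_eq_zero_iff (hM : M ∈ Matrix.symplecticGroup (Fin n) ℤ)
    (hZ : Z ∈ siegelUpperHalfSpace n) (k l : Fin n → ℤ) :
    fderiv ℂ (riemannThetaChar
        (fun i ↦ (((M.toBlocks₂₂ *ᵥ k - M.toBlocks₂₁ *ᵥ l +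
          Matrix.diag (M.toBlocks₂₁ * M.toBlocks₂₂ᵀ)) i : ℤ) : ℂ) / 2)
        (fun i ↦ (((M.toBlocks₁₁ *ᵥ l - M.toBlocks₁₂ *ᵥ k +
          Matrix.diag (M.toBlocks₁₁ * M.toBlocks₁₂ᵀ)) i : ℤ) : ℂ) / 2)
        (moeb (M.map ((↑) : ℤ → ℂ)) Z)) 0 = 0 ↔
      fderiv ℂ (riemannThetaChar (fun i ↦ (k i : ℂ) / 2) (fun i ↦ (l i : ℂ) / 2) Z) 0 = 0 := by
  rw [← thetaCharFst_half, ← thetaCharSnd_half]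
  exact fderiv_riemannThetaChar_moeb_zero_eq_zero_iff hM hZ _ _

end Transformation

/-! ### §3 GSM 2009: the loci `grad θ[ε;δ] = 0` and `(∂θ)_null` -/

section Defs

/-- **The locus `grad θ[k/2; l/2](τ) = 0` of ONE characteristic** (Grushevsky–Salvati Manni 2009: "for
any odd `[ε,δ]` the vector valued equation `grad θ[ε;δ](τ) = 0` defines a certain set of components of
`(∂θ)_null`"), as a predicate on a period matrix `Ω`: the `z`-differential of `ϑ[k/2; l/2](·, Ω)` at `0`
vanishes (characteristics with `k, l ∈ ℤⁿ`; integral shifts change `ϑ[a;b](·, Ω)` by a non-zero constant,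
`memGradThetaNullAt_add_two_mul_iff`). [cite: GrushevskySalvatiManni2009HighMultiplicity, p0006 L7–L8 and p0004 L122 of the held text] -/
def MemGradThetaNullAt (k l : Fin n → ℤ) (Ω : Matrix (Fin n) (Fin n) ℂ) : Prop :=
  fderiv ℂ (riemannThetaChar (fun i ↦ (k i : ℂ) / 2) (fun i ↦ (l i : ℂ) / 2) Ω) 0 = 0

/-- **The locus `(∂θ)_null`** (Grushevsky–Salvati Manni 2009:
"`(∂θ)_null := {(X_τ, Θ_τ) ∈ 𝒜 ∣ X_τ[2]^odd ∩ Sing Θ_τ ≠ ∅}`"), as a predicate on a period matrix `Ω`: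
SOME ODD characteristic `[k/2; l/2]` (`ᵗkl` odd) has `grad θ[k/2; l/2](Ω) = 0` — its theta constant vanishes
automatically (`riemannThetaChar_half_zero_of_odd`), so the odd two-division point `(Ωk + l)/2` is a singular
point of `Θ` (`memGradThetaNull_iff_exists_odd_twoTorsion_mem_thetaDivisorSing`).
[cite: GrushevskySalvatiManni2009HighMultiplicity, p0003 L75 of the held text] -/
def MemGradThetaNull (Ω : Matrix (Fin n) (Fin n) ℂ) : Prop :=
  ∃ k l : Fin n → ℤ, Odd (k ⬝ᵥ l) ∧ MemGradThetaNullAt k l Ω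

/-- Unfolding of `MemGradThetaNullAt`. [cite: GrushevskySalvatiManni2009HighMultiplicity, p0006 L7–L8 of the held text] -/
theorem memGradThetaNullAt_iff (k l : Fin n → ℤ) (Ω : Matrix (Fin n) (Fin n) ℂ) :
    MemGradThetaNullAt k l Ω ↔
      fderiv ℂ (riemannThetaChar (fun i ↦ (k i : ℂ) / 2) (fun i ↦ (l i : ℂ) / 2) Ω) 0 = 0 :=
  Iff.rfl

/-- Unfolding of `MemGradThetaNull`. [cite: GrushevskySalvatiManni2009HighMultiplicity, p0003 L75 of the held text] -/
theorem memGradThetaNull_iff (Ω : Matrix (Fin n) (Fin n) ℂ) :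
    MemGradThetaNull Ω ↔ ∃ k l : Fin n → ℤ, Odd (k ⬝ᵥ l) ∧ MemGradThetaNullAt k l Ω :=
  Iff.rfl

end Defs

section Basic

variable (Ω : Matrix (Fin n) (Fin n) ℂ) (hΩ : ∀ i j, Ω i j = Ω j i)
  (hpos : (Matrix.of fun i j => (Ω i j).im).PosDef)

include hΩ hpos in
/-- **EVEN characteristics satisfy `grad θ[k/2; l/2](Ω) = 0` at every `Ω`** (`ϑ[k/2; l/2](·, Ω)` is an
even function of `z`, `fderiv_riemannThetaChar_half_zero_of_even`): the even half of "this gradient is not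
identically zero if and only if the characteristic is odd".
[cite: GrushevskySalvatiManni2009HighMultiplicity, p0004 L122–L123 of the held text]
[cite: Lange2023AbelianVarietiesComplex, §2.3.4 Prop. 2.3.14 (p0105–p0106)] -/
theorem MemGradThetaNullAt.of_even {k l : Fin n → ℤ} (h : Even (k ⬝ᵥ l)) : MemGradThetaNullAt k l Ω := by
  obtain ⟨c, hc, hY⟩ := exists_pos_mul_sum_sq_le_of_posDef_im Ω hpos
  exact fderiv_riemannThetaChar_half_zero_of_even Ω hΩ hc hY k l h

/-- `c • L = 0 ↔ L = 0` for a non-zero scalar `c` and a continuous linear form `L`. [folklore] -/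
private theorem smul_clm_eq_zero_iff {c : ℂ} (hc : c ≠ 0) (L : (Fin n → ℂ) →L[ℂ] ℂ) :
    c • L = 0 ↔ L = 0 := by
  constructor
  · intro h
    ext v
    have hv := congrArg (fun T : (Fin n → ℂ) →L[ℂ] ℂ ↦ T v) h
    simp only [_root_.smul_apply, _root_.zero_apply, smul_eq_mul, mul_eq_zero] at hv
    rw [_root_.zero_apply]
    exact hv.resolve_left hc
  · intro h
    rw [h]
    ext v
    simp [_root_.smul_apply]

/-- Halving an integral characteristic shifted by `2d`: `(k + 2d)/2 = k/2 + d`. [folklore] -/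
private theorem half_add_two_mul₂ (k d : Fin n → ℤ) :
    (fun i ↦ ((k i + 2 * d i : ℤ) : ℂ) / 2) = (fun i ↦ (k i : ℂ) / 2) + fun i ↦ (d i : ℂ) := by
  funext i
  simp only [Pi.add_apply]
  push_cast
  ring

/-- **`{grad θ[k/2; l/2] = 0}` only depends on the characteristic modulo `2`**:
`Ω ∈ {grad θ[(k+2d)/2; (l+2d')/2] = 0} ↔ Ω ∈ {grad θ[k/2; l/2] = 0}` (the theta function changes by the
root of unity `e(πi ᵗk d')`). [cite: MumfordTata1, Ch. II §1]
[cite: GrushevskySalvatiManni2009HighMultiplicity, p0006 L7–L8 of the held text] -/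
theorem memGradThetaNullAt_add_two_mul_iff (k l d d' : Fin n → ℤ) :
    MemGradThetaNullAt (fun i ↦ k i + 2 * d i) (fun i ↦ l i + 2 * d' i) Ω ↔ MemGradThetaNullAt k l Ω := by
  have hne : cexp (2 * π * I * ((fun i ↦ (k i : ℂ) / 2) ⬝ᵥ fun i ↦ (d' i : ℂ))) ≠ 0 :=
    Complex.exp_ne_zero _
  rw [memGradThetaNullAt_iff, memGradThetaNullAt_iff, half_add_two_mul₂, half_add_two_mul₂,
    riemannThetaChar_charShift_fun, fderiv_const_smul_field, Pi.smul_apply, smul_clm_eq_zero_iff hne]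

end Basic

/-! ### The torus reading: `Ω ∈ (∂θ)_null ↔ X_Ω[2]^odd ∩ Sing Θ ≠ ∅` -/

section Torus

variable (Ω : Matrix (Fin n) (Fin n) ℂ) (hΩ : ∀ i j, Ω i j = Ω j i)
  (hpos : (Matrix.of fun i j => (Ω i j).im).PosDef)
  (Φ : (Fin n ⊕ Fin n → ℝ) ≃L[ℝ] (Fin n → ℂ))
  (hΦ : ∀ v i, Φ v i = (v (Sum.inl i) : ℂ) + ∑ j, Ω i j * (v (Sum.inr j) : ℂ))

include hΩ hpos in
/-- **For an ODD characteristic, `grad θ[k/2; l/2](Ω) = 0` iff the odd two-division point `(Ωk + l)/2`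
is a singular point of `{ϑ = 0}`** (the theta constant vanishes automatically; first-order reading
`riemannThetaChar_singular_zero_iff`). [cite: GrushevskySalvatiManni2009HighMultiplicity, p0003 L75 and p0004 L43 of the held text]
[cite: Lange2023AbelianVarietiesComplex, §2.3.4 Prop. 2.3.14 (proof, p0106)] -/
theorem memGradThetaNullAt_iff_singular_of_odd {k l : Fin n → ℤ} (h : Odd (k ⬝ᵥ l)) :
    MemGradThetaNullAt k l Ω ↔
      riemannTheta Ω (Ω *ᵥ (fun i ↦ (k i : ℂ) / 2) + fun i ↦ (l i : ℂ) / 2) = 0 ∧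
        fderiv ℂ (riemannTheta Ω) (Ω *ᵥ (fun i ↦ (k i : ℂ) / 2) + fun i ↦ (l i : ℂ) / 2) = 0 := by
  obtain ⟨c, hc, hY⟩ := exists_pos_mul_sum_sq_le_of_posDef_im Ω hpos
  rw [← riemannThetaChar_singular_zero_iff Ω hΩ hc hY, memGradThetaNullAt_iff]
  exact ⟨fun hd ↦ ⟨riemannThetaChar_half_zero_of_odd k l Ω h, hd⟩, fun hd ↦ hd.2⟩

include hΩ hpos hΦ in
/-- **The printed definition of `(∂θ)_null`**: `Ω ∈ (∂θ)_null ↔ X_Ω[2]^odd ∩ Sing Θ ≠ ∅`, i.e. iff some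
odd two-division point `π(½m)` (`m = (l, k) ∈ ℤⁿ ⊕ ℤⁿ`, `Σ lᵢkᵢ` odd) of the principally polarised `X_Ω`
lies on `Sing Θ`. [cite: GrushevskySalvatiManni2009HighMultiplicity, p0003 L75 of the held text] -/
theorem memGradThetaNull_iff_exists_odd_twoTorsion_mem_thetaDivisorSing :
    MemGradThetaNull Ω ↔ ∃ m : Fin n ⊕ Fin n → ℤ, Odd (∑ i, m (Sum.inl i) * m (Sum.inr i)) ∧
      proj Φ (fun i ↦ (m i : ℝ) / 2) ∈ thetaDivisorSing Ω hΩ hpos Φ hΦ := by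
  constructor
  · rintro ⟨k, l, hodd, hm⟩
    refine ⟨Sum.elim l k, ?_, ?_⟩
    · simpa only [Sum.elim_inl, Sum.elim_inr, dotProduct, mul_comm] using hodd
    · rw [proj_half_eq_cover Ω Φ hΦ, cover_mem_thetaDivisorSing_iff Ω hΩ hpos Φ hΦ]
      simpa only [Sum.elim_inl, Sum.elim_inr] using
        (memGradThetaNullAt_iff_singular_of_odd Ω hΩ hpos hodd).1 hm
  · rintro ⟨m, hodd, hm⟩
    have hodd' : Odd ((fun i ↦ m (Sum.inr i)) ⬝ᵥ fun i ↦ m (Sum.inl i)) := by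
      simpa only [dotProduct, mul_comm] using hodd
    refine ⟨fun i ↦ m (Sum.inr i), fun i ↦ m (Sum.inl i), hodd', ?_⟩
    rw [proj_half_eq_cover Ω Φ hΦ, cover_mem_thetaDivisorSing_iff Ω hΩ hpos Φ hΦ] at hm
    exact (memGradThetaNullAt_iff_singular_of_odd Ω hΩ hpos hodd').2 hm

end Torus

/-! ### `(∂θ)_null` and its components are `Sp_{2g}(ℤ)`-invariant -/

section Modular

variable {M : Matrix (Fin n ⊕ Fin n) (Fin n ⊕ Fin n) ℤ} {Z : Matrix (Fin n) (Fin n) ℂ}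

/-- **"The loci `grad θ[ε;δ](τ) = 0` for various `ε, δ` are conjugate under the action of `Γ_g`"**:
`M(Z) ∈ {grad θ[k'/2; l'/2] = 0} ↔ Z ∈ {grad θ[k/2; l/2] = 0}` for `M ∈ Sp_{2g}(ℤ)`, `Z ∈ 𝔥_g`, with GSM's
`k' = δk − γl + (γᵗδ)₀`, `l' = αl − βk + (αᵗβ)₀` (ANY characteristic, no parity hypothesis).
[cite: GrushevskySalvatiManni2009HighMultiplicity, p0006 L7–L8 of the held text]
[cite: GrushevskySalvatiManni2004Gradients, p0003 L117–L130 of the held text] -/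
theorem memGradThetaNullAt_moeb_iff (hM : M ∈ Matrix.symplecticGroup (Fin n) ℤ)
    (hZ : Z ∈ siegelUpperHalfSpace n) (k l : Fin n → ℤ) :
    MemGradThetaNullAt
        (M.toBlocks₂₂ *ᵥ k - M.toBlocks₂₁ *ᵥ l + Matrix.diag (M.toBlocks₂₁ * M.toBlocks₂₂ᵀ))
        (M.toBlocks₁₁ *ᵥ l - M.toBlocks₁₂ *ᵥ k + Matrix.diag (M.toBlocks₁₁ * M.toBlocks₁₂ᵀ))
        (moeb (M.map ((↑) : ℤ → ℂ)) Z) ↔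
      MemGradThetaNullAt k l Z := by
  rw [memGradThetaNullAt_iff, memGradThetaNullAt_iff]
  exact fderiv_riemannThetaChar_half_moeb_zero_eq_zero_iff hM hZ k l

/-- `Z ∈ {grad θ[k/2; l/2] = 0} ⟹ M(Z) ∈ {grad θ[k'/2; l'/2] = 0}`.
[cite: GrushevskySalvatiManni2009HighMultiplicity, p0006 L7–L8 of the held text] -/
theorem MemGradThetaNullAt.moeb (hM : M ∈ Matrix.symplecticGroup (Fin n) ℤ)
    (hZ : Z ∈ siegelUpperHalfSpace n) {k l : Fin n → ℤ} (hm : MemGradThetaNullAt k l Z) :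
    MemGradThetaNullAt
        (M.toBlocks₂₂ *ᵥ k - M.toBlocks₂₁ *ᵥ l + Matrix.diag (M.toBlocks₂₁ * M.toBlocks₂₂ᵀ))
        (M.toBlocks₁₁ *ᵥ l - M.toBlocks₁₂ *ᵥ k + Matrix.diag (M.toBlocks₁₁ * M.toBlocks₁₂ᵀ))
        (moeb (M.map ((↑) : ℤ → ℂ)) Z) :=
  (memGradThetaNullAt_moeb_iff hM hZ k l).2 hm

/-- The symplectic action on characteristics preserves ODD parity (complement of
`even_dotProduct_symplecticChar_iff`). [cite: GrushevskySalvatiManni2008, Definitions 5–6 (p0004 of the held text)] -/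
theorem odd_dotProduct_symplecticChar_iff (hM : M ∈ Matrix.symplecticGroup (Fin n) ℤ) (k l : Fin n → ℤ) :
    Odd ((M.toBlocks₂₂ *ᵥ k - M.toBlocks₂₁ *ᵥ l + Matrix.diag (M.toBlocks₂₁ * M.toBlocks₂₂ᵀ)) ⬝ᵥ
        (M.toBlocks₁₁ *ᵥ l - M.toBlocks₁₂ *ᵥ k + Matrix.diag (M.toBlocks₁₁ * M.toBlocks₁₂ᵀ))) ↔
      Odd (k ⬝ᵥ l) := by
  rw [← Int.not_even_iff_odd, ← Int.not_even_iff_odd, even_dotProduct_symplecticChar_iff hM]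

/-- **`Z ∈ (∂θ)_null ⟹ M(Z) ∈ (∂θ)_null`** for `M ∈ Sp_{2g}(ℤ)`, `Z ∈ 𝔥_g`: an odd characteristic with
vanishing gradient is transported to the odd characteristic `M[·]` with vanishing gradient.
[cite: GrushevskySalvatiManni2009HighMultiplicity, p0003 L75 and p0006 L7–L8 of the held text] -/
theorem MemGradThetaNull.moeb (hM : M ∈ Matrix.symplecticGroup (Fin n) ℤ)
    (hZ : Z ∈ siegelUpperHalfSpace n) (hm : MemGradThetaNull Z) :
    MemGradThetaNull (moeb (M.map ((↑) : ℤ → ℂ)) Z) := by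
  obtain ⟨k, l, hodd, hm⟩ := hm
  exact ⟨_, _, (odd_dotProduct_symplecticChar_iff hM k l).2 hodd, hm.moeb hM hZ⟩

/-- **`(∂θ)_null` is well defined on `𝒜_g = Sp_{2g}(ℤ)\𝔥_g`: `M(Z) ∈ (∂θ)_null ↔ Z ∈ (∂θ)_null`**
(`M ∈ Sp_{2g}(ℤ)`, `Z ∈ 𝔥_g`) — GSM define `(∂θ)_null ⊂ 𝒜` as a locus of ppav.
[cite: GrushevskySalvatiManni2009HighMultiplicity, p0003 L75 of the held text] -/
theorem memGradThetaNull_moeb_iff (hM : M ∈ Matrix.symplecticGroup (Fin n) ℤ)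
    (hZ : Z ∈ siegelUpperHalfSpace n) :
    MemGradThetaNull (moeb (M.map ((↑) : ℤ → ℂ)) Z) ↔ MemGradThetaNull Z := by
  refine ⟨fun hm ↦ ?_, fun hm ↦ hm.moeb hM hZ⟩
  have h' := hm.moeb (((⟨M, hM⟩ : Matrix.symplecticGroup (Fin n) ℤ)⁻¹).2) (moeb_intCast_mem hM hZ)
  rwa [moeb_symplecticInv_moeb hM hZ] at h'

/-- **Translations, one characteristic at a time**: `Z + β ∈ {grad θ[k/2; (l − βk + (β)₀)/2] = 0} ↔
Z ∈ {grad θ[k/2; l/2] = 0}` for `β` integral symmetric (`M = (1 β; 0 1)`, `γZ + δ = 1`).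
[cite: GrushevskySalvatiManni2009HighMultiplicity, p0006 L7–L8 of the held text]
[cite: Lange2023AbelianVarietiesComplex, §3.3.1 Lemma 3.3.1 (b) (p0170); §3.3.4 Exercise (7)(c)] -/
theorem memGradThetaNullAt_add_intCast_iff {β : Matrix (Fin n) (Fin n) ℤ} (hβ : β.IsSymm)
    (hZ : Z ∈ siegelUpperHalfSpace n) (k l : Fin n → ℤ) :
    MemGradThetaNullAt k (l - β *ᵥ k + Matrix.diag β) (Z + β.map ((↑) : ℤ → ℂ)) ↔
      MemGradThetaNullAt k l Z := by
  have key := memGradThetaNullAt_moeb_iff (fromBlocks_one_symm_mem_symplecticGroup hβ) hZ k l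
  simp only [Matrix.toBlocks_fromBlocks₁₁, Matrix.toBlocks_fromBlocks₁₂, Matrix.toBlocks_fromBlocks₂₁,
    Matrix.toBlocks_fromBlocks₂₂, Matrix.one_mulVec, Matrix.zero_mulVec, sub_zero, Matrix.zero_mul,
    Matrix.diag_zero, add_zero, Matrix.one_mul, Matrix.diag_transpose, moeb_translation] at key
  exact key

/-- **Translations preserve `(∂θ)_null`** (`M = (1 β; 0 1)`, `β` integral symmetric).
[cite: GrushevskySalvatiManni2009HighMultiplicity, p0003 L75 of the held text]
[cite: Lange2023AbelianVarietiesComplex, §3.3.4 Exercise (7)(c)] -/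
theorem memGradThetaNull_add_intCast_iff {β : Matrix (Fin n) (Fin n) ℤ} (hβ : β.IsSymm)
    (hZ : Z ∈ siegelUpperHalfSpace n) :
    MemGradThetaNull (Z + β.map ((↑) : ℤ → ℂ)) ↔ MemGradThetaNull Z := by
  rw [← moeb_translation β Z]
  exact memGradThetaNull_moeb_iff (fromBlocks_one_symm_mem_symplecticGroup hβ) hZ

end Modular

/-! ### §4 Odd characteristics: `0 = θ = ∂ᵢ∂ⱼθ` automatically at an odd point of order two -/

section Odd

/-- **The differential of an odd entire function is even**: `∂_u f(−z) = ∂_u f(z)` if `f(−x) = −f(x)`.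
[folklore] -/
private theorem fderiv_apply_neg_of_forall_neg {f : (Fin n → ℂ) → ℂ} (hodd : ∀ x, f (-x) = -f x)
    (hf : Differentiable ℂ f) (z u : Fin n → ℂ) :
    fderiv ℂ f (-z) u = fderiv ℂ f z u := by
  -- `f ∘ neg = −f`; differentiate both sides at `z`
  have hneg : HasFDerivAt (fun x : Fin n → ℂ ↦ -x) (-(ContinuousLinearMap.id ℂ (Fin n → ℂ))) z :=
    (hasFDerivAt_id (𝕜 := ℂ) z).neg
  have hcomp := ((hf (-z)).hasFDerivAt).comp z hneg
  have hfe : (f ∘ fun x : Fin n → ℂ ↦ -x) = fun x ↦ -f x := funext fun x ↦ hodd x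
  rw [hfe] at hcomp
  have huniq := hcomp.unique (hf z).hasFDerivAt.neg
  have hv := congrArg (fun L : (Fin n → ℂ) →L[ℂ] ℂ ↦ L (-u)) huniq
  simp only [ContinuousLinearMap.coe_comp, Function.comp_apply, _root_.neg_apply,
    ContinuousLinearMap.coe_id', id_eq, map_neg, neg_neg] at hv
  exact hv

/-- An even function which is differentiable at `0` has `df(0) = 0`. [folklore] -/
private theorem fderiv_zero_eq_zero_of_forall_neg₂ {f : (Fin n → ℂ) → ℂ} (heven : ∀ x, f (-x) = f x)
    (hf : DifferentiableAt ℂ f 0) : fderiv ℂ f 0 = 0 := by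
  have hneg : HasFDerivAt (fun x : Fin n → ℂ ↦ -x) (-(ContinuousLinearMap.id ℂ (Fin n → ℂ))) 0 :=
    (hasFDerivAt_id (𝕜 := ℂ) (0 : Fin n → ℂ)).neg
  have hf0 : HasFDerivAt f (fderiv ℂ f 0) (-(0 : Fin n → ℂ)) := by
    rw [neg_zero]
    exact hf.hasFDerivAt
  have hcomp := hf0.comp (0 : Fin n → ℂ) hneg
  have hfe : (f ∘ fun x : Fin n → ℂ ↦ -x) = f := funext fun x ↦ heven x
  rw [hfe] at hcomp
  have huniq := hcomp.unique hf.hasFDerivAt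
  ext v
  have hv := congrArg (fun L : (Fin n → ℂ) →L[ℂ] ℂ ↦ L v) huniq
  simp only [ContinuousLinearMap.coe_comp, Function.comp_apply, _root_.neg_apply,
    ContinuousLinearMap.coe_id', id_eq, map_neg] at hv
  have h2 : (2 : ℂ) * fderiv ℂ f 0 v = 0 := by linear_combination -hv
  simpa using h2

variable (Ω : Matrix (Fin n) (Fin n) ℂ) (hΩ : ∀ i j, Ω i j = Ω j i)
  (hpos : (Matrix.of fun i j => (Ω i j).im).PosDef)

include hΩ hpos in
/-- **"If `z = (τε+δ)/2 ∈ X_τ[2]` is an odd point, then `0 = θ(τ,z) = ∂ᵢ∂ⱼθ(τ,z)` automatically"**, read in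
characteristic: for `ᵗkl` odd the `z`-Hessian of `ϑ[k/2; l/2](·, Ω)` at `0` vanishes (an odd function has
even differential, which is therefore critical at `0`). [cite: GrushevskySalvatiManni2009HighMultiplicity, p0010 L37 of the held text]
[cite: Lange2023AbelianVarietiesComplex, §2.3.4 Prop. 2.3.14 (p0105–p0106)] -/
theorem hessian_riemannThetaChar_half_zero_of_odd (k l : Fin n → ℤ) (h : Odd (k ⬝ᵥ l)) :
    (Matrix.of fun i j : Fin n ↦ fderiv ℂ (fun z ↦ fderiv ℂ
        (riemannThetaChar (fun i ↦ (k i : ℂ) / 2) (fun i ↦ (l i : ℂ) / 2) Ω) z (Pi.single i (1 : ℂ))) 0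
      (Pi.single j (1 : ℂ))) = 0 := by
  obtain ⟨c, hc, hY⟩ := exists_pos_mul_sum_sq_le_of_posDef_im Ω hpos
  have hd := differentiable_riemannThetaChar Ω hΩ hc hY (fun i ↦ (k i : ℂ) / 2) (fun i ↦ (l i : ℂ) / 2)
  ext i j
  rw [Matrix.of_apply, Matrix.zero_apply]
  have heven : ∀ z, fderiv ℂ (riemannThetaChar (fun i ↦ (k i : ℂ) / 2) (fun i ↦ (l i : ℂ) / 2) Ω) (-z)
      (Pi.single i (1 : ℂ)) =
      fderiv ℂ (riemannThetaChar (fun i ↦ (k i : ℂ) / 2) (fun i ↦ (l i : ℂ) / 2) Ω) z (Pi.single i (1 : ℂ)) :=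
    fun z ↦ fderiv_apply_neg_of_forall_neg (fun x ↦ riemannThetaChar_half_neg_of_odd k l Ω x h) hd z _
  rw [fderiv_zero_eq_zero_of_forall_neg₂ heven ((differentiable_fderiv_apply_of_differentiable hd _) 0),
    _root_.zero_apply]

include hΩ hpos in
/-- **An ODD characteristic lies in every `θ_{[k,l]}^h`** (`ϑ[k/2; l/2](0, Ω) = 0` and the Hessian at `0`
is zero): this is why Definition 6 of `θ_null^h` quantifies over EVEN characteristics only.
[cite: GrushevskySalvatiManni2009HighMultiplicity, p0010 L37 of the held text]
[cite: GrushevskySalvatiManni2008, Definition 6 (p0004 of the held text)] -/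
theorem memThetaNullRankAt_of_odd (k l : Fin n → ℤ) (h : Odd (k ⬝ᵥ l)) (r : ℕ) :
    MemThetaNullRankAt k l r Ω := by
  rw [memThetaNullRankAt_iff, hessian_riemannThetaChar_half_zero_of_odd Ω hΩ hpos k l h, Matrix.rank_zero]
  exact ⟨riemannThetaChar_half_zero_of_odd k l Ω h, Nat.zero_le _⟩

end Odd

/-! ### §5 "This gradient is not identically zero if and only if the characteristic is odd" -/

section NonVanishing

/-- The matrix `Eᵢⱼ + Eⱼᵢ` is symmetric. [folklore] -/
private theorem isSymm_pairMatrix₂ (i j : Fin n) :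
    (Matrix.single i j (1 : ℤ) + Matrix.single j i 1).IsSymm := by
  unfold Matrix.IsSymm
  rw [Matrix.transpose_add, Matrix.transpose_single, Matrix.transpose_single, add_comm]

/-- `diag(Eᵢⱼ + Eⱼᵢ) = 0` for `i ≠ j`. [folklore] -/
private theorem diag_pairMatrix₂ {i j : Fin n} (hij : i ≠ j) :
    Matrix.diag (Matrix.single i j (1 : ℤ) + Matrix.single j i 1) = 0 := by
  funext m
  simp only [Matrix.diag_apply, Matrix.add_apply, Pi.zero_apply]
  rw [Matrix.single_apply_of_ne (h := fun h ↦ hij (h.1.trans h.2.symm)),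
    Matrix.single_apply_of_ne (h := fun h ↦ hij (h.1.trans h.2.symm).symm), add_zero]

/-- **The translation step for gradients** (`β = Eᵢⱼ + Eⱼᵢ`, `i ≠ j`, `(β)₀ = 0`): for `Z ∈ 𝔥_g`,
`grad ϑ[k/2; (l − βk)/2](·, Z + β)(0) = 0 ↔ grad ϑ[k/2; l/2](·, Z)(0) = 0`.
[cite: GrushevskySalvatiManni2009HighMultiplicity, p0006 L7–L8 of the held text]
[cite: Lange2023AbelianVarietiesComplex, §3.3.4 Exercise (7)(c)] -/
theorem memGradThetaNullAt_translate_pair_iff {i j : Fin n} (hij : i ≠ j) (k l : Fin n → ℤ)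
    {Z : Matrix (Fin n) (Fin n) ℂ} (hZ : Z ∈ siegelUpperHalfSpace n) :
    MemGradThetaNullAt k (fun m ↦ l m - ((Matrix.single i j (1 : ℤ) + Matrix.single j i 1) *ᵥ k) m)
        (Z + (Matrix.single i j (1 : ℤ) + Matrix.single j i 1).map ((↑) : ℤ → ℂ)) ↔
      MemGradThetaNullAt k l Z := by
  have key := memGradThetaNullAt_add_intCast_iff (isSymm_pairMatrix₂ i j) hZ k l
  rw [diag_pairMatrix₂ hij, add_zero] at key
  exact key

/-- **At a DIAGONAL period matrix a characteristic with exactly one (odd, odd) coordinate pair has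
non-zero gradient at `z = 0`**: the corresponding odd point of order two `(Ωk + l)/2` has exactly one
coordinate on a genus-one theta divisor, and `Sing Θ_{diag} = {≥ 2 coordinates on the Θᵢ}`
(`riemannTheta_diagonal_singular_iff`: simple zeros of `ϑ(·, τ)`), so it is a SMOOTH point of `Θ`.
[cite: GrushevskySalvatiManni2009HighMultiplicity, p0004 L122–L123 of the held text]
[cite: WhittakerWatson1927, §21.12] -/
theorem fderiv_riemannThetaChar_half_zero_diagonal_ne_zero (τ : Fin n → ℂ) (hτ : ∀ i, 0 < (τ i).im)
    (k l : Fin n → ℤ) (hone : (Finset.univ.filter fun m ↦ Odd (k m) ∧ Odd (l m)).card = 1) :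
    ¬ MemGradThetaNullAt k l (Matrix.diagonal τ) := by
  classical
  have hΩ := diagonal_mem_siegelUpperHalfSpace τ hτ
  have hsym : ∀ i j, Matrix.diagonal τ i j = Matrix.diagonal τ j i :=
    fun i j ↦ (hΩ.1.apply i j).symm
  -- the characteristic is odd: `#S(k,l) = 1`
  have hodd : Odd (k ⬝ᵥ l) := by
    rw [← Int.not_even_iff_odd, even_dotProduct_iff_even_card_oddSupport, hone]
    exact Nat.not_even_one
  intro hm
  obtain ⟨h0, hd⟩ := (memGradThetaNullAt_iff_singular_of_odd (Matrix.diagonal τ) hsym hΩ.2 hodd).1 hm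
  obtain ⟨i, j, hij, hi, hj⟩ := (riemannTheta_diagonal_singular_iff τ hτ _).1 ⟨h0, hd⟩
  -- both coordinates `i ≠ j` are (odd, odd): contradiction with `#S(k,l) = 1`
  have hcoord : ∀ m, jacobiTheta₂ ((Matrix.diagonal τ *ᵥ (fun i ↦ (k i : ℂ) / 2) +
      fun i ↦ (l i : ℂ) / 2) m) (τ m) = 0 → Odd (k m) ∧ Odd (l m) := by
    intro m hm0
    rw [Pi.add_apply, Matrix.mulVec_diagonal, jacobiTheta₂_eq_zero_iff (hτ m)] at hm0
    exact (exists_half_eq_halfPeriod_add_iff (hτ m) (k m) (l m)).1 hm0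
  have hiS : i ∈ Finset.univ.filter fun m ↦ Odd (k m) ∧ Odd (l m) :=
    Finset.mem_filter.2 ⟨Finset.mem_univ _, hcoord i hi⟩
  have hjS : j ∈ Finset.univ.filter fun m ↦ Odd (k m) ∧ Odd (l m) :=
    Finset.mem_filter.2 ⟨Finset.mem_univ _, hcoord j hj⟩
  obtain ⟨m₀, hm₀⟩ := Finset.card_eq_one.1 hone
  rw [hm₀, Finset.mem_singleton] at hiS hjS
  exact hij (hiS.trans hjS.symm)

/-- The induction behind the main theorem: if `#S(k,l)` is odd, `grad ϑ[k/2; l/2](·, Ω)(0) ≠ 0` for some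
`Ω ∈ 𝔥_g` (remove pairs of `S(k,l)` by the translations `Z ↦ Z + Eᵢⱼ + Eⱼᵢ` until one is left, then
evaluate at a diagonal point). [cite: GrushevskySalvatiManni2009HighMultiplicity, p0004 L122–L123 of the held text] -/
private theorem exists_not_memGradThetaNullAt_of_odd_card :
    ∀ (N : ℕ) (k l : Fin n → ℤ), (Finset.univ.filter fun m ↦ Odd (k m) ∧ Odd (l m)).card = N → Odd N →
      ∃ Ω ∈ siegelUpperHalfSpace n, ¬ MemGradThetaNullAt k l Ω := by
  intro N
  induction N using Nat.strong_induction_on with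
  | _ N ih =>
    intro k l hcard hN
    by_cases h1 : N = 1
    · subst h1
      exact ⟨Matrix.diagonal fun _ ↦ I, diagonal_mem_siegelUpperHalfSpace _ fun _ ↦ by simp,
        fderiv_riemannThetaChar_half_zero_diagonal_ne_zero _ (fun _ ↦ by simp) k l hcard⟩
    · -- two coincidences `i ≠ j`: translate by `β = Eᵢⱼ + Eⱼᵢ`
      have h3 : 3 ≤ N := by
        obtain ⟨r, hr⟩ := hN
        omega
      obtain ⟨i, hi⟩ : (Finset.univ.filter fun m ↦ Odd (k m) ∧ Odd (l m)).Nonempty :=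
        Finset.card_pos.1 (by omega)
      obtain ⟨j, hj, hji⟩ : ∃ j ∈ (Finset.univ.filter fun m ↦ Odd (k m) ∧ Odd (l m)), j ≠ i := by
        have hc : 1 < ((Finset.univ.filter fun m ↦ Odd (k m) ∧ Odd (l m))).card := by omega
        exact Finset.exists_mem_ne hc i
      have hi' := (Finset.mem_filter.1 hi).2
      have hj' := (Finset.mem_filter.1 hj).2
      set β : Matrix (Fin n) (Fin n) ℤ := Matrix.single i j (1 : ℤ) + Matrix.single j i 1 with hβ
      set l' : Fin n → ℤ := fun m ↦ l m - (β *ᵥ k) m with hl'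
      have hjmem : j ∈ (Finset.univ.filter fun m ↦ Odd (k m) ∧ Odd (l m)).erase i :=
        Finset.mem_erase.2 ⟨hji, hj⟩
      have hcard' : (Finset.univ.filter fun m ↦ Odd (k m) ∧ Odd (l' m)).card = N - 2 := by
        rw [hl', hβ, oddSupport_translate_pair hji.symm k l hi' hj', Finset.card_erase_of_mem hjmem,
          Finset.card_erase_of_mem hi, hcard]
        omega
      have hN' : Odd (N - 2) := by
        obtain ⟨r, hr⟩ := hN
        exact ⟨r - 1, by omega⟩
      obtain ⟨Ω', hΩ', hne⟩ := ih (N - 2) (by omega) k l' hcard' hN'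
      refine ⟨Ω' - β.map ((↑) : ℤ → ℂ), sub_intCast_mem_siegelUpperHalfSpace hΩ' (isSymm_pairMatrix₂ i j),
        fun h0 ↦ hne ?_⟩
      have ht := (memGradThetaNullAt_translate_pair_iff hji.symm k l
        (sub_intCast_mem_siegelUpperHalfSpace hΩ' (isSymm_pairMatrix₂ i j))).2 h0
      rw [sub_add_cancel, ← hβ] at ht
      simpa only [hl'] using ht

/-- **The gradient of an ODD theta function at `z = 0` does not vanish identically**: for `k, l ∈ ℤ^g`
with `ᵗkl` odd there is `Ω ∈ 𝔥_g` with `grad ϑ[k/2; l/2](·, Ω)(0) ≠ 0`.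
[cite: GrushevskySalvatiManni2009HighMultiplicity, p0004 L122–L123 of the held text]
[cite: GrushevskySalvatiManni2004Gradients, p0003 of the held text] -/
theorem exists_fderiv_riemannThetaChar_half_zero_ne_zero_of_odd (k l : Fin n → ℤ) (h : Odd (k ⬝ᵥ l)) :
    ∃ Ω ∈ siegelUpperHalfSpace n,
      fderiv ℂ (riemannThetaChar (fun i ↦ (k i : ℂ) / 2) (fun i ↦ (l i : ℂ) / 2) Ω) 0 ≠ 0 :=
  exists_not_memGradThetaNullAt_of_odd_card _ k l rfl
    (by rwa [← Nat.not_even_iff_odd, ← even_dotProduct_iff_even_card_oddSupport, Int.not_even_iff_odd])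

/-- **"This gradient is not identically zero if and only if the characteristic is odd"**: the
`z`-gradient of `ϑ[k/2; l/2](·, Ω)` at `0` vanishes for EVERY `Ω ∈ 𝔥_g` iff `ᵗkl` is even.
[cite: GrushevskySalvatiManni2009HighMultiplicity, p0004 L122–L123 of the held text] -/
theorem forall_fderiv_riemannThetaChar_half_zero_eq_zero_iff_even (k l : Fin n → ℤ) :
    (∀ Ω ∈ siegelUpperHalfSpace n,
        fderiv ℂ (riemannThetaChar (fun i ↦ (k i : ℂ) / 2) (fun i ↦ (l i : ℂ) / 2) Ω) 0 = 0) ↔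
      Even (k ⬝ᵥ l) := by
  refine ⟨fun hall ↦ Int.not_odd_iff_even.1 fun hodd ↦ ?_, fun heven Ω hΩ ↦ ?_⟩
  · obtain ⟨Ω, hΩ, hne⟩ := exists_fderiv_riemannThetaChar_half_zero_ne_zero_of_odd k l hodd
    exact hne (hall Ω hΩ)
  · exact MemGradThetaNullAt.of_even Ω (fun i j ↦ (hΩ.1.apply i j).symm) hΩ.2 heven

/-- Every component `{grad θ[k/2; l/2] = 0}` with `ᵗkl` odd is a PROPER subset of `𝔥_g`.
[cite: GrushevskySalvatiManni2009HighMultiplicity, p0006 L7–L8 and p0004 L122–L123 of the held text] -/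
theorem exists_not_memGradThetaNullAt_of_odd (k l : Fin n → ℤ) (h : Odd (k ⬝ᵥ l)) :
    ∃ Ω ∈ siegelUpperHalfSpace n, ¬ MemGradThetaNullAt k l Ω :=
  exists_fderiv_riemannThetaChar_half_zero_ne_zero_of_odd k l h

end NonVanishing

/-! ### Validation: genus one, and diagonal period matrices of genus `≥ 3` -/

section Validation

/-- **Genus one: `(∂θ)_null = ∅`** — the theta divisor of an elliptic curve is one smooth point
(`{ϑ = dϑ = 0} = ∅`, `not_riemannTheta_singular_fin_one`). [cite: WhittakerWatson1927, §21.12]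
[cite: GrushevskySalvatiManni2009HighMultiplicity, p0003 L75 of the held text] -/
theorem not_memGradThetaNull_fin_one (Ω : Matrix (Fin 1) (Fin 1) ℂ) (hΩ : ∀ i j, Ω i j = Ω j i)
    (hpos : (Matrix.of fun i j => (Ω i j).im).PosDef) : ¬ MemGradThetaNull Ω := by
  rintro ⟨k, l, hodd, hm⟩
  exact not_riemannTheta_singular_fin_one Ω hpos _
    ((memGradThetaNullAt_iff_singular_of_odd Ω hΩ hpos hodd).1 hm)

/-- **A diagonal period matrix of genus `g ≥ 3` lies in `(∂θ)_null`**: the odd characteristic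
`k = l = e₀ + e₁ + e₂` (three (odd, odd) coordinate pairs) has its point of order two on three coordinate
theta divisors, hence on `Sing Θ_{diag} = {≥ 2 coordinates on the Θᵢ}` — GSM 2009's "family of odd points
of order two over `𝒜₁ × 𝒜₁ × 𝒜₁`". [cite: GrushevskySalvatiManni2009HighMultiplicity, p0010 L3 and p0003 L75 of the held text]
[cite: WhittakerWatson1927, §21.12] -/
theorem memGradThetaNull_diagonal_of_three_le (hn : 3 ≤ n) (τ : Fin n → ℂ) (hτ : ∀ i, 0 < (τ i).im) :
    MemGradThetaNull (Matrix.diagonal τ) := by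
  classical
  have hΩ := diagonal_mem_siegelUpperHalfSpace τ hτ
  have hsym : ∀ i j, Matrix.diagonal τ i j = Matrix.diagonal τ j i :=
    fun i j ↦ (hΩ.1.apply i j).symm
  -- the characteristic `k = l = 𝟙_{m < 3}`
  set k : Fin n → ℤ := fun m ↦ if (m : ℕ) < 3 then 1 else 0 with hk
  have hS : (Finset.univ.filter fun m ↦ Odd (k m) ∧ Odd (k m)) =
      Finset.univ.filter fun m : Fin n ↦ (m : ℕ) < 3 := by
    ext m
    by_cases hm : (m : ℕ) < 3 <;> simp [hk, hm, Int.odd_iff]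
  have hcard : (Finset.univ.filter fun m : Fin n ↦ (m : ℕ) < 3).card = 3 := by
    have h3 : (Finset.univ.filter fun m : Fin n ↦ (m : ℕ) < 3) =
        Finset.image (Fin.castLE hn) Finset.univ := by
      ext m
      simp only [Finset.mem_filter, Finset.mem_univ, true_and, Finset.mem_image]
      constructor
      · intro hm
        exact ⟨⟨m, hm⟩, Fin.ext rfl⟩
      · rintro ⟨a, rfl⟩
        exact a.2
    rw [h3, Finset.card_image_of_injective _ (Fin.castLE_injective hn), Finset.card_univ,
      Fintype.card_fin]
  have hodd : Odd (k ⬝ᵥ k) := by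
    rw [← Int.not_even_iff_odd, even_dotProduct_iff_even_card_oddSupport, hS, hcard]
    exact Nat.not_even_iff_odd.2 (Nat.odd_iff.2 rfl)
  refine ⟨k, k, hodd, (memGradThetaNullAt_iff_singular_of_odd _ hsym hΩ.2 hodd).2 ?_⟩
  -- the point of order two has its coordinates `0, 1` (and `2`) on the genus-one theta divisors
  have hcoord : ∀ m : Fin n, (m : ℕ) < 3 → jacobiTheta₂ ((Matrix.diagonal τ *ᵥ (fun i ↦ (k i : ℂ) / 2) +
      fun i ↦ (k i : ℂ) / 2) m) (τ m) = 0 := by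
    intro m hm
    rw [Pi.add_apply, Matrix.mulVec_diagonal, jacobiTheta₂_eq_zero_iff (hτ m)]
    have hkm : k m = 1 := by simp [hk, hm]
    exact (exists_half_eq_halfPeriod_add_iff (hτ m) (k m) (k m)).2 ⟨by rw [hkm]; exact odd_one,
      by rw [hkm]; exact odd_one⟩
  have h0 : (0 : ℕ) < n := by omega
  have h1 : (1 : ℕ) < n := by omega
  exact (riemannTheta_diagonal_singular_iff τ hτ _).2 ⟨⟨0, h0⟩, ⟨1, h1⟩, by simp [Fin.ext_iff],
    hcoord _ (by simp), hcoord _ (by simp)⟩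

end Validation

end ComplexTorus

end Literature.Geometry.Kaehler

end
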